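import Mathlib
import Literature.Probability.Percolation.PercolationProofs
import Summits.CriticalPhenomena.PercolationContinuityZ3.Theorems.PercNearOneGluingAdditiveGluingGoodBase
import Summits.CriticalPhenomena.PercolationContinuityZ3.Theorems.PercNearOneGluingAdditiveGluingLemma5AnyRelay
import Summits.CriticalPhenomena.PercolationContinuityZ3.Theorems.PercNearOneGluingAdditiveGluingGoodStepUniqueLowAux
import HarnessLib

/-! # Crux `PercNearOneGluing.AdditiveGluing` (stmt-CriticalPhenomena-4576), line `subuniform-dead-pocket-maximum` —
# goodness when every neighbour of the observer is reliable off the observer (generalised base, siege k15)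

Helper file for the crux skeleton `Cruxes/AdditiveGluing/Lines/subuniform-dead-pocket-maximum.lean`;
lands with `--supports stmt-CriticalPhenomena-4576` (registered partial-result stub `stub_goodReliableNbrs_k15`).

Notation: `μ = prodBernoulli w`, `τ°(x) = μ(x ↔ b in {o}ᶜ)` (reliability with the observer deleted),
`σ_∅ = {no open non-loop pair at o}`, `C(o) = openCluster · o`.

**Theorem (generalised base).**  If `b ∈ A`, `o ∉ A` and EVERY positive-weight neighbour `y` of `o` is at
least as `τ°`-reliable as some relay (equivalently as the worst relay `a₀ = argmin_A τ°`), then `(w, A, o, b)`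
is good (Kozma–Nitzan arXiv:2401.12397 §3.2) in the skeleton's linear selection form.  KN's Theorem 4
(the landed `stub_goodBase`) is the case "every positive-weight neighbour lies in `A`"; here the low
neighbours are arbitrary provided they are `τ°`-reliable, so the inductive step `stub_goodStep` has content
only at observers with a BAD low neighbour (`τ°(y) < min_A τ°`).

Proof (KN's proof of Thm 4 with Lemma 5 for an arbitrary relay, the landed `stub_lemma5AnyRelay`):
* termwise on the fibres `σ_B` of the open star of `o` (`goodReliableNbrs_term_le`): a fibre over `B ∋ o` is
  empty, a fibre through a weight-`0` pair is null, and otherwise ANY `v ∈ B` is a positive-weight neighbour,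
  so `τ°(a₀) ≤ τ°(v)` and Lemma 5 gives `μ(σ_B ∩ {a₀ ↔ b}) ≤ μ(σ_B ∩ {o ↔ b})`;
* summing (`goodReliableNbrs_relay_le`): `τ(a₀) ≤ τ(o) + μ(σ_∅) τ°(a₀)`;
* the live/dead partition `μ(o ↔ A) + Σ_W μ(C(o) = W) = 1` (landed `stub_goodStepLiveDeadPartition`) turns the
  left side into `1 − τ(o) − Σ_W μ(C(o) = W) τ_{G−W}(sel W) ≤ 1 − τ(o) − μ(C(o) = {o}) τ°(a₀)`, and
  `σ_∅ ⊆ {C(o) = {o}}` (landed `goodStepU_isolated_subset_cluster_singleton`) finishes: `≤ 1 − τ(o) − μ(σ_∅) τ°(a₀) ≤ 1 − τ(a₀) ≤ t`.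
No new definitions. -/

namespace Summit.CriticalPhenomena.PercolationContinuityZ3.Theorems

open MeasureTheory Set
open Literature.Probability.LatticeModels (prodBernoulli)
open Literature.Probability.Percolation (BondConfig openConn openConnIn openGraph openCluster
  openGraph_adj)
open scoped BigOperators

noncomputable section
open Classical

variable {n : ℕ}

/-- **Termwise Lemma 5 under the reliable-neighbour hypothesis**: for `B ≠ ∅`,
`μ(σ_B ∩ {a₀ ↔ b}) ≤ μ(σ_B ∩ {o ↔ b})` when every positive-weight neighbour `y` of `o` has
`τ°(a₀) ≤ τ°(y)`. (Kozma–Nitzan arXiv:2401.12397, proof of Thm 4 p. 13, with Lemma 5 for any relay.) -/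
theorem goodReliableNbrs_term_le (w : Sym2 (Fin n) → unitInterval) (B : Finset (Fin n)) (o b a₀ : Fin n)
    (hbo : b ≠ o) (ha₀o : a₀ ≠ o)
    (hnbr : ∀ y : Fin n, y ≠ o → w s(o, y) ≠ 0 →
      (prodBernoulli w).real (openConnIn (({o} : Set (Fin n))ᶜ) a₀ b)
        ≤ (prodBernoulli w).real (openConnIn (({o} : Set (Fin n))ᶜ) y b))
    (hB : B ≠ ∅) :
    (prodBernoulli w).real
        ((fun ω : BondConfig (Fin n) => Finset.univ.filter fun y : Fin n => y ≠ o ∧ s(o, y) ∈ ω) ⁻¹' {B}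
          ∩ openConn a₀ b) ≤
      (prodBernoulli w).real
        ((fun ω : BondConfig (Fin n) => Finset.univ.filter fun y : Fin n => y ≠ o ∧ s(o, y) ∈ ω) ⁻¹' {B}
          ∩ openConn o b) := by
  by_cases hoB : o ∈ B
  · simp [goodBase_fibre_eq_empty o B hoB]
  rw [goodBase_fibre_eq o B hoB]
  by_cases hzero : ∃ y ∈ B, w s(o, y) = 0
  · obtain ⟨y, hyB, hy0⟩ := hzero
    have hyo : y ≠ o := fun h => hoB (h ▸ hyB)
    have hnull : (prodBernoulli w).real
        {ω : BondConfig (Fin n) | ∀ y : Fin n, y ≠ o → (s(o, y) ∈ ω ↔ y ∈ B)} = 0 :=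
      sigmaRec_null w _ {s(o, y)} (fun e he => by rw [Finset.mem_singleton.1 he]; exact hy0)
        fun ω hω => ⟨s(o, y), Finset.mem_singleton_self _, (hω y hyo).2 hyB⟩
    rw [measureReal_mono_null Set.inter_subset_left hnull]
    exact measureReal_nonneg
  · push Not at hzero
    obtain ⟨v, hvB⟩ := Finset.nonempty_iff_ne_empty.2 hB
    have hvo : v ≠ o := fun h => hoB (h ▸ hvB)
    exact stub_lemma5AnyRelay n w o b a₀ v B hbo ha₀o hoB hvB (hnbr v hvo (hzero v hvB))

/-- **The relay comparison** under the reliable-neighbour hypothesis: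
`τ(a₀) ≤ τ(o) + μ(σ_∅) · τ°(a₀)` (partition by the open star of `o`, `goodReliableNbrs_term_le` off
`B = ∅`, factorisation of the `∅`-term). (Kozma–Nitzan arXiv:2401.12397, proof of Thm 4 p. 13–14.) -/
theorem goodReliableNbrs_relay_le (w : Sym2 (Fin n) → unitInterval) (o b a₀ : Fin n)
    (hbo : b ≠ o) (ha₀o : a₀ ≠ o)
    (hnbr : ∀ y : Fin n, y ≠ o → w s(o, y) ≠ 0 →
      (prodBernoulli w).real (openConnIn (({o} : Set (Fin n))ᶜ) a₀ b)
        ≤ (prodBernoulli w).real (openConnIn (({o} : Set (Fin n))ᶜ) y b)) :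
    (prodBernoulli w).real (openConn a₀ b) ≤ (prodBernoulli w).real (openConn o b) +
      (prodBernoulli w).real {ω : BondConfig (Fin n) | ∀ y : Fin n, y ≠ o → s(o, y) ∉ ω} *
        (prodBernoulli w).real (openConnIn (({o} : Set (Fin n))ᶜ) a₀ b) := by
  have h1 := sigmaRec_sum_preimage_inter w
    (fun ω : BondConfig (Fin n) => Finset.univ.filter fun y : Fin n => y ≠ o ∧ s(o, y) ∈ ω)
    (openConn a₀ b)
  have h2 := sigmaRec_sum_preimage_inter w
    (fun ω : BondConfig (Fin n) => Finset.univ.filter fun y : Fin n => y ≠ o ∧ s(o, y) ∈ ω)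
    (openConn o b)
  have h0 : (prodBernoulli w).real
      ((fun ω : BondConfig (Fin n) => Finset.univ.filter fun y : Fin n => y ≠ o ∧ s(o, y) ∈ ω) ⁻¹' {∅}
        ∩ openConn a₀ b) =
      (prodBernoulli w).real {ω : BondConfig (Fin n) | ∀ y : Fin n, y ≠ o → s(o, y) ∉ ω} *
        (prodBernoulli w).real (openConnIn (({o} : Set (Fin n))ᶜ) a₀ b) := by
    rw [goodBase_fibre_empty, goodBase_real_isolated_inter_openConn w o a₀ b ha₀o]
  rw [← h1, ← h2]
  exact goodBase_sum_le _ _ _ h0.le measureReal_nonneg fun B hB =>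
    goodReliableNbrs_term_le w B o b a₀ hbo ha₀o hnbr hB

/-- **Generalised base — goodness when every neighbour of the observer is reliable off the observer**
(registered partial-result stub `stub_goodReliableNbrs_k15` of crux stmt-CriticalPhenomena-4576;
Kozma–Nitzan arXiv:2401.12397 §3.2: Theorem 4 is the case `N(o) ⊆ A`).  If `b ∈ A`, `o ∉ A` and every
`y ≠ o` with `w s(o,y) ≠ 0` satisfies `μ(a ↔ b in {o}ᶜ) ≤ μ(y ↔ b in {o}ᶜ)` for some `a ∈ A`, then for every
level `t` with `1 − t ≤ μ(a ↔ b)` on `A` and every selection `sel W ∈ A`: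
`μ(o ↔ A, o ↮ b) + Σ_{W ∋ o, W ∩ A = ∅} μ(C(o) = W) · μ((sel W ↔ b in Wᶜ)ᶜ) ≤ t`. -/
theorem stub_goodReliableNbrs_k15 :
    ∀ (n : ℕ) (w : Sym2 (Fin n) → unitInterval) (A : Finset (Fin n)) (o b : Fin n),
      b ∈ A → o ∉ A →
      (∀ y : Fin n, y ≠ o → (w s(o, y) : ℝ) ≠ 0 →
        ∃ a ∈ A, (prodBernoulli w).real (openConnIn (({o} : Set (Fin n))ᶜ) a b)
          ≤ (prodBernoulli w).real (openConnIn (({o} : Set (Fin n))ᶜ) y b)) →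
      ∀ (t : ℝ) (sel : Finset (Fin n) → Fin n), (∀ W, sel W ∈ A) →
        (∀ a ∈ A, 1 - t ≤ (prodBernoulli w).real (openConn a b)) →
        (prodBernoulli w).real ((⋃ a ∈ A, openConn o a) ∩ (openConn o b)ᶜ)
          + ∑ W ∈ (Finset.univ : Finset (Finset (Fin n))).filter (fun W => o ∈ W ∧ Disjoint W A),
              (prodBernoulli w).real {ω : BondConfig (Fin n) | openCluster ω o = (W : Set (Fin n))}
                * (prodBernoulli w).real (openConnIn ((W : Set (Fin n))ᶜ) (sel W) b)ᶜ
          ≤ t := by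
  intro n w A o b hbA hoA hnbr t sel hsel hrel
  have hbo : b ≠ o := fun h => hoA (h ▸ hbA)
  -- the minimiser `a₀` of `τ°` over `A`
  obtain ⟨a₀, ha₀A, hmin⟩ := Finset.exists_min_image A
    (fun x => (prodBernoulli w).real (openConnIn (({o} : Set (Fin n))ᶜ) x b)) ⟨b, hbA⟩
  have ha₀o : a₀ ≠ o := fun h => hoA (h ▸ ha₀A)
  have hnbr' : ∀ y : Fin n, y ≠ o → w s(o, y) ≠ 0 →
      (prodBernoulli w).real (openConnIn (({o} : Set (Fin n))ᶜ) a₀ b)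
        ≤ (prodBernoulli w).real (openConnIn (({o} : Set (Fin n))ᶜ) y b) := by
    intro y hyo hwy
    obtain ⟨a, haA, hay⟩ := hnbr y hyo fun h => hwy (Set.Icc.coe_eq_zero.1 h)
    exact (hmin a haA).trans hay
  -- (3) the relay comparison and the level at `a₀`
  have h3 := goodReliableNbrs_relay_le w o b a₀ hbo ha₀o hnbr'
  have hrel₀ := hrel a₀ ha₀A
  -- (4) the live failure
  have hsub : (openConn o b : Set (BondConfig (Fin n))) ⊆ ⋃ a ∈ A, openConn o a := fun ω hω =>
    Set.mem_iUnion₂.2 ⟨b, hbA, hω⟩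
  have hlive : (prodBernoulli w).real ((⋃ a ∈ A, openConn o a) ∩ (openConn o b)ᶜ) =
      (prodBernoulli w).real (⋃ a ∈ A, (openConn o a : Set (BondConfig (Fin n)))) -
        (prodBernoulli w).real (openConn o b) := by
    rw [← Set.sdiff_eq, measureReal_sdiff hsub (Set.toFinite _).measurableSet (measure_ne_top _ _)]
  -- (5) the live/dead partition
  have hpart := stub_goodStepLiveDeadPartition n w A o
  -- (6) the penalty: every term is at most its pocket mass, and the pocket `{o}` pays `τ°(a₀)`
  have hmem : ({o} : Finset (Fin n)) ∈
      (Finset.univ : Finset (Finset (Fin n))).filter (fun W => o ∈ W ∧ Disjoint W A) :=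
    Finset.mem_filter.2 ⟨Finset.mem_univ _, Finset.mem_singleton_self o,
      Finset.disjoint_singleton_left.2 hoA⟩
  have hterm : ∀ W ∈ (Finset.univ : Finset (Finset (Fin n))).filter (fun W => o ∈ W ∧ Disjoint W A),
      (prodBernoulli w).real {ω : BondConfig (Fin n) | openCluster ω o = (W : Set (Fin n))}
          * (prodBernoulli w).real (openConnIn ((W : Set (Fin n))ᶜ) (sel W) b)ᶜ =
        (prodBernoulli w).real {ω : BondConfig (Fin n) | openCluster ω o = (W : Set (Fin n))} -
          (prodBernoulli w).real {ω : BondConfig (Fin n) | openCluster ω o = (W : Set (Fin n))}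
            * (prodBernoulli w).real (openConnIn ((W : Set (Fin n))ᶜ) (sel W) b) := by
    intro W _
    rw [probReal_compl_eq_one_sub (Set.toFinite _).measurableSet]
    ring
  have hpen : ∑ W ∈ (Finset.univ : Finset (Finset (Fin n))).filter (fun W => o ∈ W ∧ Disjoint W A),
      (prodBernoulli w).real {ω : BondConfig (Fin n) | openCluster ω o = (W : Set (Fin n))}
        * (prodBernoulli w).real (openConnIn ((W : Set (Fin n))ᶜ) (sel W) b)ᶜ ≤
      ∑ W ∈ (Finset.univ : Finset (Finset (Fin n))).filter (fun W => o ∈ W ∧ Disjoint W A),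
          (prodBernoulli w).real {ω : BondConfig (Fin n) | openCluster ω o = (W : Set (Fin n))} -
        (prodBernoulli w).real
            {ω : BondConfig (Fin n) | openCluster ω o = ((({o} : Finset (Fin n))) : Set (Fin n))} *
          (prodBernoulli w).real (openConnIn (({o} : Set (Fin n))ᶜ) a₀ b) := by
    rw [Finset.sum_congr rfl hterm, Finset.sum_sub_distrib]
    have hsingle : (prodBernoulli w).real
          {ω : BondConfig (Fin n) | openCluster ω o = ((({o} : Finset (Fin n))) : Set (Fin n))} *
            (prodBernoulli w).real (openConnIn (((({o} : Finset (Fin n))) : Set (Fin n)))ᶜ (sel {o}) b) ≤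
        ∑ W ∈ (Finset.univ : Finset (Finset (Fin n))).filter (fun W => o ∈ W ∧ Disjoint W A),
          (prodBernoulli w).real {ω : BondConfig (Fin n) | openCluster ω o = (W : Set (Fin n))}
            * (prodBernoulli w).real (openConnIn ((W : Set (Fin n))ᶜ) (sel W) b) :=
      Finset.single_le_sum (f := fun W : Finset (Fin n) =>
          (prodBernoulli w).real {ω : BondConfig (Fin n) | openCluster ω o = (W : Set (Fin n))}
            * (prodBernoulli w).real (openConnIn ((W : Set (Fin n))ᶜ) (sel W) b))
        (fun W _ => mul_nonneg measureReal_nonneg measureReal_nonneg) hmem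
    have hsel₀ : (prodBernoulli w).real (openConnIn (({o} : Set (Fin n))ᶜ) a₀ b) ≤
        (prodBernoulli w).real (openConnIn (((({o} : Finset (Fin n))) : Set (Fin n)))ᶜ (sel {o}) b) := by
      rw [Finset.coe_singleton]
      exact hmin (sel {o}) (hsel {o})
    have hC₀ : 0 ≤ (prodBernoulli w).real
        {ω : BondConfig (Fin n) | openCluster ω o = ((({o} : Finset (Fin n))) : Set (Fin n))} :=
      measureReal_nonneg
    nlinarith [mul_le_mul_of_nonneg_left hsel₀ hC₀]
  -- (7) `σ_∅ ⊆ {C(o) = {o}}`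
  have hσ : (prodBernoulli w).real {ω : BondConfig (Fin n) | ∀ y : Fin n, y ≠ o → s(o, y) ∉ ω} ≤
      (prodBernoulli w).real
        {ω : BondConfig (Fin n) | openCluster ω o = ((({o} : Finset (Fin n))) : Set (Fin n))} :=
    measureReal_mono (goodStepU_isolated_subset_cluster_singleton o)
  have hτ₀ : 0 ≤ (prodBernoulli w).real (openConnIn (({o} : Set (Fin n))ᶜ) a₀ b) := measureReal_nonneg
  -- (8) add up
  rw [hlive]
  nlinarith [mul_le_mul_of_nonneg_right hσ hτ₀]

end

end Summit.CriticalPhenomena.PercolationContinuityZ3.Theorems
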